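import Literature.NumberTheory.Automorphic.IwahoriDatumGL
import Literature.NumberTheory.Automorphic.ParabolicGLReindex
import Literature.NumberTheory.Automorphic.ParabolicInductionModulusProofs
import HarnessLib

/-!
# Jacquet's lemma for `GL_n(F)`: discharge of `Representation.isAdmissible_jacquetGL`

Let `F` be a non-archimedean local field, `n` a finite index type, `c : n → α` a block labelling
with values in a finite linear order, and `P_c = M_c U_c ≤ GL_n(F)` the standard parabolic
subgroup. The named fact `Representation.isAdmissible_jacquetGL F c` (file `ParabolicGL`) says
that the Jacquet functor `r_c = Representation.jacquetGL F c` (the `U_c`-coinvariants with the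
action of `Π_a GL_{n_a}(F) ≅ M_c`) carries admissible complex representations of `GL_n(F)` to
admissible representations of `Π_a GL_{n_a}(F)` (Bernstein–Zelevinsky 1977, §2.3, Proposition,
part (e), p. 446: "proved by Jacquet"; Casselman 1995, Thm. 3.3.1). This file proves it,
`Representation.isAdmissible_jacquetGL_holds`, sorry-free, with no new definition and no new
named fact: theorems only.

## Proof

The tree already holds the two halves of Casselman's proof (§3.3, via Prop. 1.4.4):

* the abstract Jacquet lemma for a parabolic triple with an Iwahori datum, in the form of
  **Jacquet's first lemma for `r_c`**,
  `Literature.NumberTheory.Automorphic.fixedPoints_jacquetGL_le_map` (file `IwahoriDatumGL`): for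
  a *monotone* labelling `c : Fin N → Fin r`, an admissible `π` and the Levi level
  `B_j = {b : diag b ∈ K_j}` of the principal congruence subgroup `K_j = K_{|ϖ|^{j+1}}`, every
  `B_j`-fixed vector of `r_c(π)` is the class of a `K_j`-fixed vector of `π`; in particular
  `r_c(π)^{B_j}` is finite-dimensional;
* the reindexing apparatus of `Literature.NumberTheory.Automorphic.ParabolicGLReindex`: every
  labelling `c : n → α` is order-equivalent, along an enumeration `e : Fin N ≃ n`, to a monotone
  `c'' : Fin N → Fin r` (`exists_monotone_relabelling`); `reindexGL e : GL_N(F) ≃* GL_n(F)` maps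
  `P_{c''}` onto `P_c` and `U_{c''}` onto `U_c`, and induces the continuous surjection of Levi
  factors `Θ = leviReindexHom : Π_b GL(B''_b) → Π_a GL(B_a)`.

Given an admissible `π` of `GL_n(F)` and an open subgroup `K` of `Π_a GL(B_a)`: `π' = π ∘ reindexGL e`
is admissible (`IsAdmissible.comp_mulEquiv`); `Θ⁻¹(K)` is a neighbourhood of `1`, hence contains
some Levi level `B_j` (the block-diagonal embedding induces the topology of the Levi, its left
inverse `P → Π_b GL(B''_b)` being continuous: `exists_nhds_preimage_blockDiagonalGL_subset`); the
identity on representatives is an isomorphism `r_{c''}(π') ≅ r_c(π) ∘ Θ` of representations of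
`Π_b GL(B''_b)` (`nonempty_jacquetGL_reindex_equiv`: the kernels `V(U_{c''})` and `V(U_c)` agree,
and `reindexGL e (diag b) = diag(Θ b) · u` with `u ∈ U_c` acting trivially on `r_c(π)`); so
`r_c(π)^K ⊆ r_c(π)^{Θ(B_j)} ≅ r_{c''}(π')^{B_j}` is finite-dimensional. Smoothness of `r_c(π)` is
`Representation.IsSmooth.jacquetGL`.

## References

* I. N. Bernstein, A. V. Zelevinsky, *Induced representations of reductive 𝔭-adic groups. I*,
  Ann. Sci. ÉNS (4) 10 (1977), 441–472, §2.3 Proposition (e), p. 446.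
* W. Casselman, *Introduction to the theory of admissible representations of 𝔭-adic reductive
  groups* (draft, 1995), Prop. 1.4.4, Thm. 3.3.1, Thm. 3.3.3.
-/

open scoped MatrixGroups Pointwise
open ValuativeRel

namespace Literature.NumberTheory.Automorphic

open Representation

/-! ### The kernel of `V → r_c(π)` -/

section KerCoinvariants

variable {k : Type*} [CommRing k] (R : Type*) [CommRing R] {m : Type*} [Fintype m] [DecidableEq m]
  {β : Type*} [LinearOrder β] (d : m → β) {V : Type*} [AddCommGroup V] [Module k V]

/-- The kernel `V(U_d)` of `V → r_d(π)` is spanned by the vectors `π(u) v - v`, `u ∈ U_d ≤ GL_m(R)`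
(the generators of Mathlib's `Representation.Coinvariants.ker` for `π|_{U_d}`, the subgroup
`U_d^P ≤ P_d` being `U_d` by `unipotentRadicalGL_subgroupOf`). [folklore] -/
private theorem coinvariantsKer_restrictUnipotentGL_eq_span (π : Representation k (GL m R) V) :
    Coinvariants.ker (restrictUnipotentGL R d π) =
      Submodule.span k {x | ∃ g ∈ unipotentRadicalGL R d, ∃ v : V, π g v - v = x} := by
  unfold Coinvariants.ker
  congr 1
  ext x
  constructor
  · rintro ⟨⟨u, v⟩, rfl⟩
    refine ⟨((u : standardParabolicGL R d) : GL m R), ?_, v, rfl⟩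
    have hu : (u : standardParabolicGL R d) ∈
        (unipotentRadicalGL R d).subgroupOf (standardParabolicGL R d) := by
      rw [unipotentRadicalGL_subgroupOf]
      exact u.2
    exact Subgroup.mem_subgroupOf.1 hu
  · rintro ⟨g, hg, v, rfl⟩
    have hgP : g ∈ standardParabolicGL R d := unipotentRadicalGL_le R d hg
    have hgU : (⟨g, hgP⟩ : standardParabolicGL R d) ∈ unipotentRadicalP R d := by
      rw [← unipotentRadicalGL_subgroupOf, Subgroup.mem_subgroupOf]
      exact hg
    exact ⟨(⟨⟨g, hgP⟩, hgU⟩, v), rfl⟩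

end KerCoinvariants

/-! ### `r_{c''}(π ∘ reindexGL e) ≅ r_c(π) ∘ Θ` -/

section ReindexEquiv

variable (F : Type*) [Field F] {n : Type*} [Fintype n] [DecidableEq n] {α : Type*} [LinearOrder α]
  [Fintype α] {N r : ℕ} {c : n → α} {e : Fin N ≃ n} {c'' : Fin N → Fin r}
  (hcc : ∀ i j, c'' i < c'' j ↔ c (e i) < c (e j))
  {V : Type*} [AddCommGroup V] [Module ℂ V]

include hcc in
omit [Fintype α] in
/-- **The kernels agree**: `V(U_{c''})` for `π ∘ reindexGL e` is `V(U_c)` for `π`, because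
`reindexGL e` maps `U_{c''}` onto `U_c` (`reindexGL_mem_unipotentRadicalGL_iff`). [folklore] -/
private theorem coinvariantsKer_reindex_eq (π : Representation ℂ (GL n F) V) :
    Coinvariants.ker (restrictUnipotentGL F c'' (π.comp (reindexGL (k := F) e).toMonoidHom)) =
      Coinvariants.ker (restrictUnipotentGL F c π) := by
  rw [coinvariantsKer_restrictUnipotentGL_eq_span, coinvariantsKer_restrictUnipotentGL_eq_span]
  congr 1
  ext x
  constructor
  · rintro ⟨g, hg, v, rfl⟩
    exact ⟨reindexGL (k := F) e g, (reindexGL_mem_unipotentRadicalGL_iff F hcc g).2 hg, v, rfl⟩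
  · rintro ⟨g, hg, v, rfl⟩
    refine ⟨(reindexGL (k := F) e).symm g, (reindexGL_mem_unipotentRadicalGL_iff F hcc _).1 ?_, v, ?_⟩
    · rw [MulEquiv.apply_symm_apply]
      exact hg
    · change π ((reindexGL (k := F) e) ((reindexGL (k := F) e).symm g)) v - v = π g v - v
      rw [MulEquiv.apply_symm_apply]

include hcc in
/-- **`r_{c''}(π ∘ reindexGL e) ≅ r_c(π) ∘ Θ`** as representations of `Π_b GL(B''_b, F)`, where
`Θ = leviReindexHom` is the homomorphism of Levi factors induced by `reindexGL e`: both carriers are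
`V / V(U_c)` (`coinvariantsKer_reindex_eq`, `Submodule.quotEquivOfEq`), and the identity on
representatives intertwines the actions because `reindexGL e (diag b) = diag(Θ b) · u` in `P_c`
with `u ∈ U_c` (`leviProjection ∘ leviEmbeddingP = id`), `U_c` acting trivially on `r_c(π)`
(Bernstein–Zelevinsky 1977, §2.3: `r` only depends on the partition up to the order of the
indices). [folklore] -/
private theorem nonempty_jacquetGL_reindex_equiv (π : Representation ℂ (GL n F) V) :
    Nonempty ((jacquetGL F c'' (π.comp (reindexGL (k := F) e).toMonoidHom)).Equiv
      ((jacquetGL F c π).comp (leviReindexHom F c e c'' hcc))) := by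
  refine ⟨Representation.Equiv.mk (Submodule.quotEquivOfEq _ _ (coinvariantsKer_reindex_eq F hcc π))
    fun b => Coinvariants.hom_ext (LinearMap.ext fun v => ?_)⟩
  -- `p = reindexGL e (diag b) ∈ P_c` factors as `diag(Θ b) · u` with `u ∈ U_c`
  have hu : (leviEmbeddingP F c (leviProjection F c
        (parabolicReindex F c e c'' hcc (leviEmbeddingP F c'' b))))⁻¹ *
      parabolicReindex F c e c'' hcc (leviEmbeddingP F c'' b) ∈ unipotentRadicalP F c := by
    rw [MonoidHom.mem_ker, map_mul, map_inv, leviProjection_leviEmbeddingP_apply, inv_mul_cancel]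
  have key : π (reindexGL (k := F) e (blockDiagonalGL F c'' b)) v =
      π (blockDiagonalGL F c (leviProjection F c
          (parabolicReindex F c e c'' hcc (leviEmbeddingP F c'' b))))
        (π (((leviEmbeddingP F c (leviProjection F c
              (parabolicReindex F c e c'' hcc (leviEmbeddingP F c'' b))))⁻¹ *
            parabolicReindex F c e c'' hcc (leviEmbeddingP F c'' b) : standardParabolicGL F c) :
            GL n F) v) := by
    rw [← Module.End.mul_apply, ← map_mul, Subgroup.coe_mul, Subgroup.coe_inv, coe_leviEmbeddingP,
      mul_inv_cancel_left]
    rfl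
  change Coinvariants.mk (restrictUnipotentGL F c π) (π (reindexGL (k := F) e (blockDiagonalGL F c'' b)) v) =
    Coinvariants.mk (restrictUnipotentGL F c π) (π (blockDiagonalGL F c (leviProjection F c
      (parabolicReindex F c e c'' hcc (leviEmbeddingP F c'' b)))) v)
  rw [key, ← jacquetGL_mk, ← jacquetGL_mk]
  congr 1
  exact Coinvariants.mk_self_apply (restrictUnipotentGL F c π) ⟨_, hu⟩ v

end ReindexEquiv

/-! ### Neighbourhoods of `1` in the Levi -/

section Nhds

variable (F : Type*) [Field F] [ValuativeRel F] [TopologicalSpace F] [IsNonarchimedeanLocalField F]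
  {m : Type*} [Fintype m] [DecidableEq m] {β : Type*} [LinearOrder β] [Fintype β] (d : m → β)

omit [Fintype β] in
/-- Continuity of the Levi projection `P_d → Π_b GL(B_b, F)` (private copy of
`continuous_leviProjection` of `ParabolicSemidirect`, not imported because of its adelic
dependencies; cf. `ParabolicGLReindex`). [folklore] -/
private theorem continuous_leviProjection₆ : Continuous (leviProjection F d) := by
  haveI : IsTopologicalRing F := inferInstance
  refine continuous_pi fun a => Units.continuous_iff.2 ⟨?_, ?_⟩
  · exact continuous_matrix fun i j =>
      (Units.continuous_val.comp continuous_subtype_val).matrix_elem (i : m) (j : m)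
  · exact continuous_matrix fun i j =>
      ((Units.continuous_val.comp continuous_subtype_val).comp continuous_inv).matrix_elem
        (i : m) (j : m)

/-- **The block-diagonal embedding induces the topology of the Levi** (the half needed here):
every neighbourhood of `1` in `Π_b GL(B_b, F)` contains the preimage under `blockDiagonalGL` of a
neighbourhood of `1` in `GL_m(F)`, because the Levi projection `P_d → Π_b GL(B_b, F)` is a
continuous left inverse of the embedding `Π_b GL(B_b, F) → P_d`. [folklore] -/
private theorem exists_nhds_preimage_blockDiagonalGL_subset {W : Set (Π b, GL {i // d i = b} F)}
    (hW : W ∈ nhds (1 : Π b, GL {i // d i = b} F)) :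
    ∃ U ∈ nhds (1 : GL m F), blockDiagonalGL F d ⁻¹' U ⊆ W := by
  have h1 : leviProjection F d ⁻¹' W ∈ nhds (1 : standardParabolicGL F d) :=
    (continuous_leviProjection₆ F d).continuousAt.preimage_mem_nhds (by rwa [map_one])
  obtain ⟨U, hU, hUW⟩ := (mem_nhds_subtype _ _ _).1 h1
  refine ⟨U, hU, fun b hb => ?_⟩
  have h2 : leviEmbeddingP F d b ∈ leviProjection F d ⁻¹' W := hUW hb
  rwa [Set.mem_preimage, leviProjection_leviEmbeddingP_apply] at h2

end Nhds

end Literature.NumberTheory.Automorphic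

/-! ### The discharge -/

namespace Representation

open Literature.NumberTheory.Automorphic

/-- **Jacquet's lemma for `GL_n(F)`** — discharge of the named fact
`Representation.isAdmissible_jacquetGL` (file `ParabolicGL`): for a non-archimedean local field
`F`, any finite index type `n` and any block labelling `c : n → α` (labels in a finite linear
order), the Jacquet functor `r_c` carries admissible representations of `GL_n(F)` to admissible
representations of `Π_a GL_{n_a}(F)`. Bernstein–Zelevinsky 1977, §2.3, Proposition, part (e),
p. 446 ("It was proved by Jacquet that `r_{M,G}` carries admissible representations into
admissible ones"); Casselman 1995, Thm. 3.3.1. Proof: reduction to a monotone labelling of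
`Fin N` along `reindexGL` (`exists_monotone_relabelling`, `leviReindexHom`,
`nonempty_jacquetGL_reindex_equiv`), where it is Jacquet's first lemma
`fixedPoints_jacquetGL_le_map` for the Iwahori datum `iwahoriDatumGL` of the principal congruence
subgroups; see the module docstring. The binders are exactly the parameters of the fact (`F` with
its instances, `n`, `α`, `c`); there is no hypothesis.
[cite: BernsteinZelevinsky1977, §2.3 Proposition (e), p. 446] -/
theorem isAdmissible_jacquetGL_holds (F : Type*) [Field F] [ValuativeRel F] [TopologicalSpace F]
    [IsNonarchimedeanLocalField F] {n : Type*} [Fintype n] [DecidableEq n] {α : Type*}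
    [LinearOrder α] [Fintype α] (c : n → α) : isAdmissible_jacquetGL F c := by
  intro V _ _ π hπ
  haveI : IsTopologicalRing F := inferInstance
  obtain ⟨N, r, e, c'', hmono, hcc⟩ := exists_monotone_relabelling c
  obtain ⟨ϖ, hϖ0, hϖ1⟩ := exists_valuation_pos_lt_one (F := F)
  -- `π' = π ∘ reindexGL e` is admissible
  have hπ' : IsAdmissible (π.comp (reindexGL (k := F) e).toMonoidHom) :=
    hπ.comp_mulEquiv (reindexGL (k := F) e) (continuous_reindexGL e) (isOpenMap_reindexGL e)
  refine ⟨hπ.isSmooth.jacquetGL F c, fun K _ => ?_⟩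
  -- Step 1: `Θ⁻¹(K)` is a neighbourhood of `1` in the Levi of `c''`; it contains a Levi level
  -- `B_j = {b : diag b ∈ K_j}` of a principal congruence subgroup `K_j`
  have hW : leviReindexHom F c e c'' hcc ⁻¹' ((K : Subgroup (Π a, GL {i // c i = a} F)) : Set _) ∈
      nhds (1 : Π b, GL {i // c'' i = b} F) :=
    (continuous_leviReindexHom F c e c'' hcc).continuousAt.preimage_mem_nhds
      (by rw [map_one]; exact K.mem_nhds_one)
  obtain ⟨U, hU, hUW⟩ := exists_nhds_preimage_blockDiagonalGL_subset F c'' hW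
  obtain ⟨j, hj⟩ := (iwahoriDatumGL hmono hϖ0 hϖ1).hasBasis_K U hU
  have hBK : ((congruenceGL N (valuation F ϖ ^ (j + 1))).comap (blockDiagonalGL F c'')).map
      (leviReindexHom F c e c'' hcc) ≤ (K : Subgroup (Π a, GL {i // c i = a} F)) := by
    rintro _ ⟨b, hb, rfl⟩
    have hb₁ : blockDiagonalGL F c'' b ∈ ((iwahoriDatumGL hmono hϖ0 hϖ1).K j : Set (GL (Fin N) F)) := hb
    have hb₂ : b ∈ blockDiagonalGL F c'' ⁻¹' U := hj hb₁
    exact hUW hb₂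
  -- Step 2: Jacquet's first lemma for `r_{c''}(π')`: `r_{c''}(π')^{B_j}` is finite-dimensional
  haveI : Module.Finite ℂ ((jacquetGL F c'' (π.comp (reindexGL (k := F) e).toMonoidHom)).fixedPoints
      ((congruenceGL N (valuation F ϖ ^ (j + 1))).comap (blockDiagonalGL F c''))) := by
    haveI : Module.Finite ℂ (Representation.fixedPoints (π.comp (reindexGL (k := F) e).toMonoidHom)
        (congruenceGL N (valuation F ϖ ^ (j + 1)))) :=
      hπ'.2 ⟨_, (iwahoriDatumGL hmono hϖ0 hϖ1).isOpen_K j⟩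
        ((iwahoriDatumGL hmono hϖ0 hϖ1).isCompact_K j)
    exact Submodule.finiteDimensional_of_le
      (fixedPoints_jacquetGL_le_map hmono hϖ0 hϖ1 _ hπ' j)
  -- Step 3: transport along `r_{c''}(π') ≅ r_c(π) ∘ Θ` and `r_c(π)^K ⊆ r_c(π)^{Θ(B_j)}`
  obtain ⟨E⟩ := nonempty_jacquetGL_reindex_equiv F hcc π
  have hfin : Module.Finite ℂ (Representation.fixedPoints
      ((jacquetGL F c π).comp (leviReindexHom F c e c'' hcc))
      ((congruenceGL N (valuation F ϖ ^ (j + 1))).comap (blockDiagonalGL F c''))) := by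
    rw [E.fixedPoints_eq_map]
    infer_instance
  rw [fixedPoints_comp] at hfin
  exact Submodule.finiteDimensional_of_le ((jacquetGL F c π).fixedPoints_antitone hBK)

end Representation
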